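/-
Copyright: the b2b-balaban T⁴-continuum CRUX team, row NE7b OWNER lineage `t4-ne7b-p1` (gen 123). Project licence.
-/
import Summits.QuantumFields.BalabanUV.T4Continuum.Spine.NE7b.SupZdPropagatorSymmetry

/-!
# THE INFINITE-VOLUME COARSE OPERATOR IS SYMMETRIC: on `ℤ^d`, the bounded block columns are superpositions of the bounded point columns,
# `Ψ_{b′} = Σ_{q′ ∈ B n b′}G(·, q′)` ((181) uniqueness + linearity of the displayed operator), hence the Schur-complement entries
# `T_∞(b,b′) = (n+1)^{−d}Σ_{q ∈ B n b}Ψ_{b′}(q) = (n+1)^{−d}Σ_{q ∈ B n b}Σ_{q′ ∈ B n b′}G(q,q′)` are SYMMETRIC, `T_∞(b,b′) = T_∞(b′,b)`, by (183) — the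
# self-adjointness half of the infinite-volume next-scale Hessian (row NE7b, node U5c; (181)∕(183) BY NAME; [folklore])

Cell `pub-balaban`, sub-cell `t4`, spine estimate NE7b (`T4WeightBudget.RelWeightBound`; the cell's OWN estimate — NOT PRINTED in
[Bałaban 1983–89], NOT PROVED).  Crux-route work under `Spine/NE7b/` by the row OWNER (`t4-ne7b-p1` gen 123, file (187)) under FREEZE
(0)'s crux-prover clause; NOTHING of Bałaban's is named as a Lean object, valued or asserted; no `T4Continuum/Support` leaf typed; no `def`,
no notation (the `ℤ^d` operator DISPLAYED; `G`, `Ψ`, `T_∞` not defined — statements about ANY bounded point ∕ block columns); zero `sorry`.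
Imports (BY NAME): the OWNER's (183) `…SupZdPropagatorSymmetry` (`zd_propagator_symmetric`; through it (181) `zd_bounded_solution_unique`,
[B6] `mem_B`, `sum_B_const`).

WHY (located).  (186) gave the entries, decay and [B6] floor of `T_∞ = Q′H_∞⁻¹Q′*`; its inversion on `ℓ²(ℤ^d)` (the sequel) wants
self-adjointness, i.e. `T_∞(b,b′) = T_∞(b′,b)`.  On the torus this is (134) `schur_symm` from (133) `action_form_symm`; on `ℤ^d` there is no
finite pairing, but (183) already moved the symmetry of the POINT columns through the tower, and the block columns are finite
superpositions of point columns: the displayed operator is additive (§1), the superposition is bounded and solves `H_VΨ = 𝟙_{B n b′}`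
(`Σ_{q′ ∈ B n b′}𝟙_{q′} = 𝟙[blk n · = b′]`), so (181) identifies it with `Ψ_{b′}`; the double block sum is then symmetric by (183) and `Σ`-exchange.

WHAT IS PROVED ([folklore]; `X d = ℤ^d`; the `ℤ^d` operator `(H_V u)(p) = (n+1)²Σ_μ(2u p − u(p + ê_μ) − u(p − ê_μ)) + a(n+1)^{−d}Σ_{q ∈ B n (blk n p)}u q
+ V p·u p` DISPLAYED):
* §1 `zd_action_add`, **`zd_action_finset_sum`** (the displayed operator is additive ∕ commutes with finite sums).
* §2 **`blockColumn_eq_sum_pointColumns`** (`d ≥ 3`, class hypotheses, `V : ℤ^d → [−λ, Λ]`, bounded point columns `H_VG_{q′} = 𝟙_{q′}` and a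
  bounded block column `H_VΨ = 𝟙[blk n · = b′]` ⟹ `Ψ = Σ_{q′ ∈ B n b′}G_{q′}`).
* §3 **`zd_coarse_symmetric`** (bounded point columns `G` and bounded block columns `Ψ` ⟹
  `(n+1)^{−d}Σ_{q ∈ B n b}Ψ_{b′} q = (n+1)^{−d}Σ_{q′ ∈ B n b′}Ψ_b q′`).
* §4 toy (`d = 3`).

HONEST (what this is NOT).  Symmetry only (the inverse of `T_∞` and its locality are the sequel); `d ≥ 3` only; the LINEAR column only;
scalar skeleton ((A3), NC-NE7b-α UNRULED); nothing of the covariant propagators of [B4]–[B6]; nothing of Bałaban's.  BY-NAME EFFECT ON THE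
WALL: NONE.  NE7b NOT PRINTED ∕ NOT PROVED; spine PROVED 0∕9; rung (B)+1 — the programme's measures remain FINITE-torus statements; NOT the
mass gap, NOT Clay.  HONEST DEPENDENCY: continuum YM on T⁴ ⇐ BetaPertH ∧ nine spine estimates (0∕9 proved); BetaPertH ⇐ (D1) ∧ (D4) ∧
CAP+tail; G-an2-4 gates asym, D1 and NE2∕3∕4.
-/

set_option autoImplicit false

noncomputable section

namespace Summit.QuantumFields.BalabanUV.T4Continuum.NE7b.SupZdCoarseSymmetry

open Real Filter Topology
open Literature.MathematicalPhysics.QuantumFieldTheory.Balaban1983to89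
open B6QGQLower276 (X e blk B side side_facts chart mem_B sum_B sum_B_const card_cube blk_chart)
open Beta (Site siteOf windowMap siteOf_windowMap siteOf_add siteOf_sub)
open SupZdPropagatorUniqueness (zd_bounded_solution_unique)
open SupZdPropagatorSymmetry (zd_propagator_symmetric)

variable {d : ℕ}

/-! ## §1. The displayed `ℤ^d` operator is additive -/

/-- The displayed `ℤ^d` operator is additive: `H_V(u + v) = H_Vu + H_Vv` pointwise (written out). [folklore] -/
theorem zd_action_add (n : ℕ) (a : ℝ) (V u v : X d → ℝ) (p : X d) :
    ((n : ℝ) + 1) ^ 2 * ∑ μ, (2 * (u p + v p) - (u (p + e μ) + v (p + e μ)) - (u (p - e μ) + v (p - e μ)))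
        + a / ((n : ℝ) + 1) ^ d * ∑ q ∈ B n (blk n p), (u q + v q) + V p * (u p + v p)
      = (((n : ℝ) + 1) ^ 2 * ∑ μ, (2 * u p - u (p + e μ) - u (p - e μ)) + a / ((n : ℝ) + 1) ^ d * ∑ q ∈ B n (blk n p), u q + V p * u p)
        + (((n : ℝ) + 1) ^ 2 * ∑ μ, (2 * v p - v (p + e μ) - v (p - e μ)) + a / ((n : ℝ) + 1) ^ d * ∑ q ∈ B n (blk n p), v q + V p * v p) := by
  have e1 : ∑ μ, (2 * (u p + v p) - (u (p + e μ) + v (p + e μ)) - (u (p - e μ) + v (p - e μ)))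
      = ∑ μ, (2 * u p - u (p + e μ) - u (p - e μ)) + ∑ μ, (2 * v p - v (p + e μ) - v (p - e μ)) := by
    rw [← Finset.sum_add_distrib]; exact Finset.sum_congr rfl fun μ _ => by ring
  rw [e1, Finset.sum_add_distrib]
  ring

/-- **THE DISPLAYED `ℤ^d` OPERATOR COMMUTES WITH FINITE SUMS**: `H_V(Σ_{i ∈ I}u_i) = Σ_{i ∈ I}H_Vu_i` pointwise (written out). [folklore] -/
theorem zd_action_finset_sum (n : ℕ) (a : ℝ) (V : X d → ℝ) {ι : Type*} (I : Finset ι) (u : ι → X d → ℝ) (p : X d) :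
    ((n : ℝ) + 1) ^ 2 * ∑ μ, (2 * (∑ i ∈ I, u i p) - (∑ i ∈ I, u i (p + e μ)) - (∑ i ∈ I, u i (p - e μ)))
        + a / ((n : ℝ) + 1) ^ d * ∑ q ∈ B n (blk n p), (∑ i ∈ I, u i q) + V p * (∑ i ∈ I, u i p)
      = ∑ i ∈ I, (((n : ℝ) + 1) ^ 2 * ∑ μ, (2 * u i p - u i (p + e μ) - u i (p - e μ))
        + a / ((n : ℝ) + 1) ^ d * ∑ q ∈ B n (blk n p), u i q + V p * u i p) := by
  classical
  induction I using Finset.induction_on with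
  | empty => simp
  | insert j I hj ih =>
    simp only [Finset.sum_insert hj]
    rw [zd_action_add n a V (u j) (fun p' => ∑ i ∈ I, u i p') p, ih]

/-! ## §2. Block columns are superpositions of point columns -/

/-- **`Ψ_{b′} = Σ_{q′ ∈ B n b′}G(·, q′)` ON `ℤ^d`**: for `V : ℤ^d → [−λ, Λ]`, bounded point columns `H_VG_{q′} = 𝟙_{q′}` and a bounded block column
`H_VΨ = 𝟙[blk n · = b′]`, `d ≥ 3` — the superposition is bounded, solves the block equation (§1; `Σ_{q′ ∈ B n b′}𝟙_{q′}(p) = 𝟙[blk n p = b′]` by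
[B6] `mem_B`), and (181) identifies it with `Ψ`. [folklore] -/
theorem blockColumn_eq_sum_pointColumns (hd : 3 ≤ d) (a : ℝ) (ha : 0 < a) {lam Lam : ℝ} (hlam : lam < min 2 a) (hLam : 0 ≤ Lam)
    (n : ℕ) (V : X d → ℝ) (hV : ∀ p, -lam ≤ V p) (hV' : ∀ p, V p ≤ Lam)
    (G : X d → X d → ℝ) (BG : X d → ℝ) (hGB : ∀ q' p, |G q' p| ≤ BG q')
    (hG : ∀ q' p, ((n : ℝ) + 1) ^ 2 * ∑ μ, (2 * G q' p - G q' (p + e μ) - G q' (p - e μ))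
      + a / ((n : ℝ) + 1) ^ d * ∑ q ∈ B n (blk n p), G q' q + V p * G q' p = if p = q' then 1 else 0)
    (b' : X d) (Ψ : X d → ℝ) {BΨ : ℝ} (hΨB : ∀ p, |Ψ p| ≤ BΨ)
    (hΨ : ∀ p, ((n : ℝ) + 1) ^ 2 * ∑ μ, (2 * Ψ p - Ψ (p + e μ) - Ψ (p - e μ))
      + a / ((n : ℝ) + 1) ^ d * ∑ q ∈ B n (blk n p), Ψ q + V p * Ψ p = if blk n p = b' then 1 else 0) :
    Ψ = fun p => ∑ q' ∈ B n b', G q' p := by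
  classical
  refine zd_bounded_solution_unique hd a ha hlam hLam n V hV hV' (fun p => if blk n p = b' then (1 : ℝ) else 0) Ψ
    (fun p => ∑ q' ∈ B n b', G q' p) (B₂ := ∑ q' ∈ B n b', BG q') hΨB (fun p => ?_) hΨ (fun p => ?_)
  · exact (Finset.abs_sum_le_sum_abs _ _).trans (Finset.sum_le_sum fun q' _ => hGB q' p)
  · rw [zd_action_finset_sum n a V (B n b') G p]
    simp only [hG]
    rw [Finset.sum_ite_eq]
    by_cases hp : blk n p = b'
    · rw [if_pos (mem_B.2 hp), if_pos hp]
    · rw [if_neg (fun h => hp (mem_B.1 h)), if_neg hp]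

/-! ## §3. THE END: the infinite-volume coarse operator is symmetric -/

/-- **HEADLINE — `T_∞(b,b′) = T_∞(b′,b)`**: for `V : ℤ^d → [−λ, Λ]`, bounded point columns `G` and bounded block columns `Ψ` of `H_V` on `ℤ^d`,
`d ≥ 3`, every mesh: `(n+1)^{−d}Σ_{q ∈ B n b}Ψ_{b′} q = (n+1)^{−d}Σ_{q′ ∈ B n b′}Ψ_b q′` — §2 on both sides, (183) `zd_propagator_symmetric`
termwise, and exchange of the two finite block sums. [folklore] -/
theorem zd_coarse_symmetric (hd : 3 ≤ d) (a : ℝ) (ha : 0 < a) {lam Lam : ℝ} (hlam : lam < min 2 a) (hLam : 0 ≤ Lam)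
    (n : ℕ) (V : X d → ℝ) (hV : ∀ p, -lam ≤ V p) (hV' : ∀ p, V p ≤ Lam)
    (G : X d → X d → ℝ) (BG : X d → ℝ) (hGB : ∀ q' p, |G q' p| ≤ BG q')
    (hG : ∀ q' p, ((n : ℝ) + 1) ^ 2 * ∑ μ, (2 * G q' p - G q' (p + e μ) - G q' (p - e μ))
      + a / ((n : ℝ) + 1) ^ d * ∑ q ∈ B n (blk n p), G q' q + V p * G q' p = if p = q' then 1 else 0)
    (Ψ : X d → X d → ℝ) (BΨ : X d → ℝ) (hΨB : ∀ b' p, |Ψ b' p| ≤ BΨ b')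
    (hΨ : ∀ b' p, ((n : ℝ) + 1) ^ 2 * ∑ μ, (2 * Ψ b' p - Ψ b' (p + e μ) - Ψ b' (p - e μ))
      + a / ((n : ℝ) + 1) ^ d * ∑ q ∈ B n (blk n p), Ψ b' q + V p * Ψ b' p = if blk n p = b' then 1 else 0)
    (b b' : X d) :
    (((n : ℝ) + 1) ^ d)⁻¹ * ∑ q ∈ B n b, Ψ b' q = (((n : ℝ) + 1) ^ d)⁻¹ * ∑ q' ∈ B n b', Ψ b q' := by
  classical
  have h1 := blockColumn_eq_sum_pointColumns hd a ha hlam hLam n V hV hV' G BG hGB hG b' (Ψ b') (hΨB b') (hΨ b')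
  have h2 := blockColumn_eq_sum_pointColumns hd a ha hlam hLam n V hV hV' G BG hGB hG b (Ψ b) (hΨB b) (hΨ b)
  rw [h1, h2]
  simp only
  rw [Finset.sum_comm]
  congr 1
  refine Finset.sum_congr rfl fun q' _ => Finset.sum_congr rfl fun q _ => ?_
  -- `G q′ q = G q q′` by (183)
  exact zd_propagator_symmetric hd a ha hlam hLam n V hV hV' q' q (G q') (G q) (hGB q') (hGB q) (hG q') (hG q)

/-! ## §4. Toy -/

/-- Toy (`d = 3`, `n = 0`, `V = 0`, `a = 1`): the displayed operator is additive — checked on `u = v = 0` at the origin. -/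
example : (((0 : ℕ) : ℝ) + 1) ^ 2 * ∑ _μ : Fin 3, (2 * ((0 : ℝ) + 0) - ((0 : ℝ) + 0) - ((0 : ℝ) + 0))
      + 1 / (((0 : ℕ) : ℝ) + 1) ^ 3 * ∑ _q ∈ B 0 (blk 0 (0 : X 3)), ((0 : ℝ) + 0) + (0 : ℝ) * ((0 : ℝ) + 0)
    = ((((0 : ℕ) : ℝ) + 1) ^ 2 * ∑ _μ : Fin 3, (2 * (0 : ℝ) - 0 - 0) + 1 / (((0 : ℕ) : ℝ) + 1) ^ 3 * ∑ _q ∈ B 0 (blk 0 (0 : X 3)), (0 : ℝ)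
        + 0 * 0)
      + ((((0 : ℕ) : ℝ) + 1) ^ 2 * ∑ _μ : Fin 3, (2 * (0 : ℝ) - 0 - 0) + 1 / (((0 : ℕ) : ℝ) + 1) ^ 3 * ∑ _q ∈ B 0 (blk 0 (0 : X 3)), (0 : ℝ)
        + 0 * 0) :=
  zd_action_add (d := 3) 0 1 (fun _ => 0) (fun _ => 0) (fun _ => 0) 0

end Summit.QuantumFields.BalabanUV.T4Continuum.NE7b.SupZdCoarseSymmetry
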